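import Literature.NumberTheory.GaloisRepresentations.GlobalArtinMapOfCharactersProofs
import Literature.NumberTheory.GaloisRepresentations.ArtinCharacterReciprocityProofs
import Literature.NumberTheory.GaloisRepresentations.HeckeCharacterMuAlgGalConjTwist
import Literature.NumberTheory.EllipticCurves.DeShalit1987.KatzDistributionFromLMeasure
import Literature.NumberTheory.NumberFields.RayClassFieldIdelic
import HarnessLib

/-!
# The `p`-adic avatar of the finite-order Hecke character attached to a character of a finite
# abelian Galois group (Tate, Cassels–Fröhlich VII §3–§5; de Shalit 1987 II.4.13: "a character of
# finite order … may be regarded as a `p`-adic character of `𝒢`")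

De Shalit II.4.13 (p. 69): every Grössencharacter of type `A₀` and conductor dividing `𝔣p^∞` — in
particular every character of FINITE ORDER of `𝒢 = Gal(K(𝔣p^∞)/K)` — is regarded as a `p`-adic
character of `𝒢`. In the tree's currency (`IsPAdicAvatarOf ι ε e` / `IsPAdicAvatarOutside S ι ε e`:
the Serre dictionary "arithmetic Frobenius ↦ `ι⁻¹(ε(ϖ_v))⁻¹`" between a Hecke character `ε` and a
rank-one framed `p`-adic Galois representation `e`), this file supplies, for a finite abelian `L ⊆ K̄`
and a character `χ : G(L|K) →* ℚ̄_pˣ`: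

* §1 `inflateCharacterPadic L χ : FramedGaloisRep K ℚ̄_p 1` — the rank-one representation `χ ∘ r_L`
  (the `ℚ̄_p`-valued twin of the tree's `inflateCharacter`, `GlobalArtinMapOfCharactersProofs.lean`),
  its matrix entry, ★ `avatarValueAt_inflateCharacterPadic` (`= χ(σ|_L)` read in `ℂ_p`),
  unramifiedness and the Frobenius characteristic polynomial `X − χ(Frob_v)` at the primes unramified
  in `L`;
* §2 `padicCharHecke L ι χ : HeckeCharacter K` — **the finite-order Hecke character of `χ` read in
  `ℂ` through `ι : ℚ̄_p ≃ ℂ`** (the tree's `charHecke` of Tate VII §4.2 for `ι ∘ χ`, with the PROVED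
  reciprocity law `artinReciprocity_character_holds`): finite order, infinity type `(0, 0)`,
  unramified with `ω(ϖ_v) = ι(χ(Frob_v))` at every `v` unramified in `L`;
* §3 ★★ `isPAdicAvatarOutside_padicCharHecke` — **`χ⁻¹ ∘ r_L` is a `p`-adic avatar of `ω_χ` outside
  any `S` off which `L` is unramified** (the inverse is the tree's normalisation: arithmetic Frobenius
  ↦ `ι⁻¹(ω(ϖ_v))⁻¹ = χ(Frob_v)⁻¹`), with `avatarValueAt (χ⁻¹ ∘ r_L) σ = (χ(σ|_L))⁻¹`; and the
  ray-class-field instance (`L = K(𝔪)`, unramified at `v ∤ 𝔪`).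

This is the input "finite-order `χ` ↦ (Hecke character, avatar)" of the `j = 0` uniqueness of the
Katz–de Shalit measure (Fourier inversion on `Gal(K(𝔣′)/K)` needs every character of that group as
the avatar of a Hecke character in the range of II.4.14). DEFINITIONS WITH BODIES and theorems; no
named fact, no instance, no `sorry`.

## References

* [CasselsFrohlichANT1967] J. Tate, *Global class field theory*, Ch. VII §3.1, §4.2 Corollary, §5.1.
* [deShalit1987] E. de Shalit, *Iwasawa theory of elliptic curves with complex multiplication* (1987),
  II.4.13 (p. 69), II.4.16 (49) (p. 76).
* [SerreAbelianLadic1968] J.-P. Serre, *Abelian ℓ-adic representations*, Ch. II §2.7.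
-/

noncomputable section

open scoped NumberField Polynomial
open NumberField IsDedekindDomain IsDedekindDomain.HeightOneSpectrum Field Polynomial
open Literature.NumberTheory.EllipticCurves

namespace Literature.NumberTheory.GaloisRepresentations

variable {p : ℕ} [Fact p.Prime]

/-! ### §1. The rank-one `p`-adic representation `χ ∘ r_L` -/

section Inflate

variable {K : Type} [Field K] (L : IntermediateField K (AlgebraicClosure K)) [FiniteDimensional K L]
  [Normal K L]

/-- **The rank-one representation `χ ∘ r_L : Γ_K → GL_1(ℚ̄_p)`** inflated from a character
`χ : G(L|K) → ℚ̄_pˣ` (continuous: trivial on the open `Gal(K̄|L)`); the `ℚ̄_p`-valued twin of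
`inflateCharacter`. [cite: CasselsFrohlichANT1967, Ch. VII §3 (PDF p. 210)] [cite: deShalit1987, II.4.13 (p. 69)] -/
def inflateCharacterPadic (χ : (L ≃ₐ[K] L) →* (PadicAlgCl p)ˣ) : FramedGaloisRep K (PadicAlgCl p) 1 :=
  ContinuousMonoidHom.comp
    (FramedRep.unitsContinuousMulEquivOfUnique (Fin 1) (PadicAlgCl p) :
      (PadicAlgCl p)ˣ →ₜ* GL (Fin 1) (PadicAlgCl p))
    ⟨χ.comp (absRestrictNormalHom L),
      MonoidHom.continuous_of_isOpen_ker _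
        (Subgroup.isOpen_mono (fun γ hγ ↦ by
          rw [MonoidHom.mem_ker] at hγ ⊢
          rw [MonoidHom.comp_apply, hγ, map_one]) (isOpen_ker_absRestrictNormalHom L))⟩

variable (χ : (L ≃ₐ[K] L) →* (PadicAlgCl p)ˣ)

/-- Unfolding lemma for `inflateCharacterPadic`. [cite: CasselsFrohlichANT1967, Ch. VII §3 (PDF p. 210)] -/
theorem inflateCharacterPadic_apply (γ : absoluteGaloisGroup K) :
    inflateCharacterPadic L χ γ =
      FramedRep.unitsContinuousMulEquivOfUnique (Fin 1) (PadicAlgCl p) (χ (absRestrictNormalHom L γ)) :=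
  rfl

/-- Matrix entries of `inflateCharacterPadic`. [cite: CasselsFrohlichANT1967, Ch. VII §3 (PDF p. 210)] -/
theorem inflateCharacterPadic_apply_coe (γ : absoluteGaloisGroup K) (i j : Fin 1) :
    ((inflateCharacterPadic L χ γ : GL (Fin 1) (PadicAlgCl p)) : Matrix (Fin 1) (Fin 1) (PadicAlgCl p)) i j =
      χ (absRestrictNormalHom L γ) :=
  rfl

/-- `charpoly (χ ∘ r_L)(γ) = X - χ(γ|_L)`. [cite: CasselsFrohlichANT1967, Ch. VII §3 (PDF p. 210)] -/
theorem charpoly_inflateCharacterPadic (γ : absoluteGaloisGroup K) :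
    FramedRep.charpoly (inflateCharacterPadic L χ) γ =
      X - C ((χ (absRestrictNormalHom L γ) : (PadicAlgCl p)ˣ) : PadicAlgCl p) := by
  rw [FramedGaloisRep.charpoly_eq_of_rank_one, inflateCharacterPadic_apply_coe]

/-- ★ **The avatar value of `χ ∘ r_L` is `χ(σ|_L)` read in `ℂ_p`.** [cite: deShalit1987, II.4.13 (p. 69)] -/
theorem avatarValueAt_inflateCharacterPadic (γ : absoluteGaloisGroup K) :
    avatarValueAt (inflateCharacterPadic L χ) γ =
      (((χ (absRestrictNormalHom L γ) : (PadicAlgCl p)ˣ) : PadicAlgCl p) : ℂ_[p]) := by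
  rw [avatarValueAt, Matrix.GeneralLinearGroup.val_det_apply, Matrix.det_fin_one,
    inflateCharacterPadic_apply_coe]

/-- The avatar value of `χ⁻¹ ∘ r_L` is `(χ(σ|_L))⁻¹`. [cite: deShalit1987, II.4.13 (p. 69)] -/
theorem avatarValueAt_inflateCharacterPadic_inv (γ : absoluteGaloisGroup K) :
    avatarValueAt (inflateCharacterPadic L χ⁻¹) γ =
      ((((χ (absRestrictNormalHom L γ) : (PadicAlgCl p)ˣ) : PadicAlgCl p) : ℂ_[p]))⁻¹ := by
  rw [avatarValueAt_inflateCharacterPadic, MonoidHom.inv_apply, Units.val_inv_eq_inv_val,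
    PadicComplex.coe_eq, PadicComplex.coe_eq, map_inv₀]

variable [NumberField K] [NumberField L] [IsGalois K L]

/-- **`χ ∘ r_L` is unramified at every prime unramified in `L`.** [cite: CasselsFrohlichANT1967, Ch. VII §3.1] -/
theorem inflateCharacterPadic_isUnramifiedAt {v : HeightOneSpectrum (𝓞 K)}
    (hunr : Algebra.IsUnramifiedIn (𝓞 L) v.asIdeal) : (inflateCharacterPadic L χ).IsUnramifiedAt v := by
  intro 𝔓 h𝔓 g hg
  rw [inflateCharacterPadic_apply, absRestrictNormalHom_eq_one_of_isUnramifiedIn L hunr h𝔓 hg, map_one,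
    map_one]

/-- **At a prime `v` unramified in the abelian `L`, the Frobenius characteristic polynomial of `χ ∘ r_L`
is `X - χ(Frob_v)`**, `Frob_v = galFrob K L v`. [cite: CasselsFrohlichANT1967, Ch. VII §3.1] -/
theorem inflateCharacterPadic_hasFrobCharpolyAt (hcomm : ∀ a b : L ≃ₐ[K] L, Commute a b)
    {v : HeightOneSpectrum (𝓞 K)} (hunr : Algebra.IsUnramifiedIn (𝓞 L) v.asIdeal) :
    (inflateCharacterPadic L χ).HasFrobCharpolyAt v
      (X - C ((χ (galFrob K L v) : (PadicAlgCl p)ˣ) : PadicAlgCl p)) := by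
  intro 𝔓 h𝔓 σ hσ
  haveI : 𝔓.IsPrime := h𝔓.1
  have hP := comap_ringOfIntegersToIntegralClosure_mem_primesOver_of_mem_primesAbove L h𝔓
  have hrσ := isArithFrobAt_absRestrictNormalHom L hσ
  have heq : absRestrictNormalHom L σ = galFrob K L v := eq_galFrob hcomm hunr hP hrσ
  rw [charpoly_inflateCharacterPadic, heq]

end Inflate

/-! ### §2. The finite-order Hecke character of `χ`, read in `ℂ` through `ι : ℚ̄_p ≃ ℂ` -/

section Hecke

variable {K : Type} [Field K] [NumberField K] (L : IntermediateField K (AlgebraicClosure K))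
  [FiniteDimensional K L] [NumberField L] [IsAbelianGalois K L] (ι : PadicAlgCl p ≃+* ℂ)
  (χ : (L ≃ₐ[K] L) →* (PadicAlgCl p)ˣ)

/-- **The Hecke character `ω_χ` of a `ℚ̄_p`-valued character `χ` of `G(L|K)`**: the finite-order
Hecke character of Tate VII §4.2 attached to `ι ∘ χ` (`charHecke` with the tree's proved reciprocity
law `artinReciprocity_character_holds`). [cite: CasselsFrohlichANT1967, Ch. VII §4.2 Corollary (iii), §5.1 (A)]
[cite: deShalit1987, II.4.13 (p. 69)] -/
def padicCharHecke : HeckeCharacter K :=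
  charHecke L ((Units.map (ι : PadicAlgCl p →+* ℂ).toMonoidHom).comp χ) artinReciprocity_character_holds

omit [NumberField L] in
/-- `ω_χ` has finite order. [cite: CasselsFrohlichANT1967, Ch. VII §3.8] -/
theorem padicCharHecke_isFiniteOrder : (padicCharHecke L ι χ).IsFiniteOrder :=
  charHecke_isFiniteOrder L _ _

omit [NumberField L] in
/-- `ω_χ` has infinity type `(0, 0)`. [cite: NeukirchANT1999, Ch. VII §6 Prop. (6.9)] -/
theorem padicCharHecke_hasInfinityType_zero :
    (padicCharHecke L ι χ).HasInfinityType (fun _ ↦ 0) (fun _ ↦ 0) :=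
  HeckeCharacter.IsFiniteOrder.hasInfinityType_zero (padicCharHecke_isFiniteOrder L ι χ)

/-- `ω_χ` is unramified at every prime unramified in `L`. [cite: CasselsFrohlichANT1967, Ch. VII §4.2 Corollary (iii)] -/
theorem padicCharHecke_isUnramifiedAt {v : HeightOneSpectrum (𝓞 K)}
    (hunr : Algebra.IsUnramifiedIn (𝓞 L) v.asIdeal) : (padicCharHecke L ι χ).IsUnramifiedAt v :=
  charHecke_isUnramifiedAt L _ _ hunr

/-- **`ω_χ(ϖ_v) = ι(χ(Frob_v))`** at every prime `v` unramified in `L`.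
[cite: CasselsFrohlichANT1967, Ch. VII §4.2 Corollary (iii)] -/
theorem padicCharHecke_valueAtUniformizer {v : HeightOneSpectrum (𝓞 K)}
    (hunr : Algebra.IsUnramifiedIn (𝓞 L) v.asIdeal) :
    (padicCharHecke L ι χ).valueAtUniformizer v = ι ((χ (galFrob K L v) : (PadicAlgCl p)ˣ) : PadicAlgCl p) := by
  rw [padicCharHecke, charHecke_valueAtUniformizer L _ _ hunr]
  rfl

/-- The Serre dictionary value: `ι⁻¹(ω_χ(ϖ_v))⁻¹ = χ(Frob_v)⁻¹ = χ⁻¹(Frob_v)`.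
[cite: SerreAbelianLadic1968, Ch. II §2.7] -/
theorem inv_symm_padicCharHecke_valueAtUniformizer {v : HeightOneSpectrum (𝓞 K)}
    (hunr : Algebra.IsUnramifiedIn (𝓞 L) v.asIdeal) :
    (ι.symm ((padicCharHecke L ι χ).valueAtUniformizer v))⁻¹ =
      ((χ⁻¹ (galFrob K L v) : (PadicAlgCl p)ˣ) : PadicAlgCl p) := by
  rw [padicCharHecke_valueAtUniformizer L ι χ hunr, RingEquiv.symm_apply_apply, MonoidHom.inv_apply,
    Units.val_inv_eq_inv_val]

/-! ### §3. `χ⁻¹ ∘ r_L` is a `p`-adic avatar of `ω_χ` off the ramified primes of `L` -/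

/-- ★★ **`χ⁻¹ ∘ r_L` is a `p`-adic avatar of `ω_χ` OUTSIDE any finite `S` off which `L` is unramified**
(at `v ∉ S`, `v ∤ p`: `L` unramified at `v`, so `χ⁻¹ ∘ r_L` is unramified there with Frobenius
characteristic polynomial `X − χ(Frob_v)⁻¹ = X − ι⁻¹(ω_χ(ϖ_v))⁻¹`). [cite: deShalit1987, II.4.13 (p. 69), II.4.16 (49) (p. 76)]
[cite: SerreAbelianLadic1968, Ch. II §2.7] -/
theorem isPAdicAvatarOutside_padicCharHecke (S : Finset (HeightOneSpectrum (𝓞 K)))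
    (hS : ∀ v : HeightOneSpectrum (𝓞 K), v ∉ S → ((p : ℕ) : 𝓞 K) ∉ v.asIdeal →
      Algebra.IsUnramifiedIn (𝓞 L) v.asIdeal) :
    IsPAdicAvatarOutside S ι (padicCharHecke L ι χ) (inflateCharacterPadic L χ⁻¹) := by
  intro v hvS hvp _
  have hunr := hS v hvS hvp
  refine ⟨inflateCharacterPadic_isUnramifiedAt L χ⁻¹ hunr, ?_⟩
  rw [inv_symm_padicCharHecke_valueAtUniformizer L ι χ hunr]
  exact inflateCharacterPadic_hasFrobCharpolyAt L χ⁻¹ (commute_of_isAbelianGalois L) hunr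

/-- ★★ **The absolute dictionary when `L` is unramified at every `v ∤ p` where `ω_χ` is unramified** —
in particular whenever `L` is unramified away from `p`... stated in the usable form: if `L` is unramified
at every prime not dividing `p`, then `χ⁻¹ ∘ r_L` IS the `p`-adic avatar of `ω_χ`
(`IsPAdicAvatarOf`). [cite: deShalit1987, II.4.13 (p. 69)] [cite: SerreAbelianLadic1968, Ch. II §2.7] -/
theorem isPAdicAvatarOf_padicCharHecke
    (hL : ∀ v : HeightOneSpectrum (𝓞 K), ((p : ℕ) : 𝓞 K) ∉ v.asIdeal → Algebra.IsUnramifiedIn (𝓞 L) v.asIdeal) :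
    IsPAdicAvatarOf ι (padicCharHecke L ι χ) (inflateCharacterPadic L χ⁻¹) :=
  isPAdicAvatarOutside_empty_iff.mp
    (isPAdicAvatarOutside_padicCharHecke L ι χ ∅ fun v _ hvp ↦ hL v hvp)

end Hecke

/-! ### §4. The ray class field `K(𝔪)`: every character of `Gal(K(𝔪)/K)` is the avatar of a finite-order
Hecke character unramified outside `𝔪` -/

section RayClass

open Literature.NumberTheory.NumberFields

variable {K : Type} [Field K] [NumberField K] {𝔪 : Ideal (𝓞 K)} (h𝔪 : 𝔪 ≠ ⊥) (ι : PadicAlgCl p ≃+* ℂ)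
  (χ : (rayClassField K 𝔪 ≃ₐ[K] rayClassField K 𝔪) →* (PadicAlgCl p)ˣ)

include h𝔪 in
/-- `ω_χ` for `L = K(𝔪)` is unramified at every `v ∤ 𝔪`. [cite: NeukirchANT1999, Ch. VI §6 Cor. (6.6)]
[cite: deShalit1987, II.4.13 (p. 69)] -/
theorem padicCharHecke_rayClassField_isUnramifiedAt {v : HeightOneSpectrum (𝓞 K)} (hv : ¬ 𝔪 ≤ v.asIdeal) :
    (padicCharHecke (rayClassField K 𝔪) ι χ).IsUnramifiedAt v :=
  padicCharHecke_isUnramifiedAt _ ι χ (isUnramifiedIn_rayClassField h𝔪 hv)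

include h𝔪 in
/-- ★★ **Every `ℚ̄_p`-valued character `χ` of `Gal(K(𝔪)/K)` is, through `χ⁻¹ ∘ r_{K(𝔪)}`, the
`p`-adic avatar outside `S` of the finite-order Hecke character `ω_χ`, for any finite `S` containing
the primes of `𝔪` not above `p`** — de Shalit's "characters of finite order of `𝒢(𝔣p^∞)` as
`p`-adic characters". [cite: deShalit1987, II.4.13 (p. 69), II.4.16 (49) (p. 76)] -/
theorem isPAdicAvatarOutside_padicCharHecke_rayClassField (S : Finset (HeightOneSpectrum (𝓞 K)))
    (hS : ∀ v : HeightOneSpectrum (𝓞 K), v ∉ S → ((p : ℕ) : 𝓞 K) ∉ v.asIdeal → ¬ 𝔪 ≤ v.asIdeal) :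
    IsPAdicAvatarOutside S ι (padicCharHecke (rayClassField K 𝔪) ι χ)
      (inflateCharacterPadic (rayClassField K 𝔪) χ⁻¹) :=
  isPAdicAvatarOutside_padicCharHecke _ ι χ S fun v hvS hvp ↦
    isUnramifiedIn_rayClassField h𝔪 (hS v hvS hvp)

end RayClass

end Literature.NumberTheory.GaloisRepresentations

end
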